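import Mathlib
import Literature.NumberTheory.LFunctions.Zhang2022.Section17Phi3minusOffDiag
import Literature.NumberTheory.LFunctions.Zhang2022.Section17Eq173Sizes
import HarnessLib

/-!
# Zhang (2022) §17 (17.8): sizes of the coefficient sequences of `Φ₃⁻(p)` — `ϱ*_≤ ≪ τ₄`,
# `(bχ)∗ν₁* ≪ τ₆`, and the divisor-sum bookkeeping the refined off-diagonal bound consumes

Topic `Literature/NumberTheory/LFunctions/Zhang2022` (Landau–Siegel audit tree; verdict-neutral).
Y. Zhang, *Discrete mean estimates and the Landau–Siegel zero*, arXiv:2211.02515v1 (2022)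
[Zhang2022LandauSiegel] — **an unrefereed manuscript under adjudication; nothing here asserts or
denies its Theorems 1–2.** §17 p. 98 ((17.8), "in a way similar to the proof of (17.3)"; χ-twisted
reading `Typed.Section17.Eq17_8Chi`). Third file of the (17.8)χ discharge (after
`Section17Phi3minusLine`, `Section17Phi3minusOffDiag`): the SIZE inputs, with absolute constants
(no Assumption (A)):

* `norm_varrhoLe_le_tau` — `|ϱ*_≤(m)| ≤ τ₄(m)` (`ϱ*_≤ = (ν·[≤D⁴]) ∗ κ̄₂`, `|ν| ≤ τ₂`, `|κ̄₂| ≤ τ₂`);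
* `norm_bchiConv_le_tau` — `|((bχ)∗ν₁*)(n)| ≤ (1+|ι₂|)(|ι₃|+|ι₄|)·τ₆(n)` for `log D ≥ 2`
  (`|bχ| ≤ Kτ₂` (15.2), `|ν₁*| ≤ τ₄`);
* `sum_norm_mul_rpow_le_of_tau` — for `|f| ≤ Kτ_j` and `e ≥ −1`:
  `Σ_{1≤n<M} |f(n)|·n^e ≤ K·X^{e+1}·(majorantConst(j²,2j)(log X)^{j²} + 1 + log X)` (`M ≤ X+1`, `X ≥ 2`),
  from the tree's `MeanSquareMajorant.sum_tau_sq_div_le` and `τ ≤ τ² + 1`;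
* `sum_norm_mul_norm_div_le_of_tau` — `Σ_{1≤n<M}|f(n)||g(n)|/n ≪ (log X)^{O(1)}` likewise;
* `tsum_norm_term_le_of_rpow` — `Σ_m|a(m)|m^{−3/2} ≤ C·Σ_m m^{−5/4}` when `|a(m)| ≤ Cm^{1/4}`
  (generic form of `Section17Eq173Sizes.tsum_norm_term_nuStar_le`).

Theorems only, 0 defs; the assembly of `Eq17_8Chi` (with the `l = D⁴` boundary term and the
`o(p)` bookkeeping) is the sequel `Section17Eq178Chi`.

## References

* Y. Zhang, arXiv:2211.02515v1 (2022), §17 p. 98 ((17.8)); §15 (15.2); §3 p. 12.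
  [cite: Zhang2022LandauSiegel, §17 (17.8) p. 98]
-/
noncomputable section

open Complex Real ComplexConjugate Finset

namespace Literature.NumberTheory.LFunctions.Zhang2022.Phi3Minus

open Literature.NumberTheory.LFunctions.Zhang2022
open Literature.NumberTheory.LFunctions.Zhang2022.Skeleton
open Literature.NumberTheory.LFunctions.Zhang2022.Typed.Section17
open Literature.NumberTheory.LFunctions.Zhang2022.MeanSquareMajorant (tau majorantConst)
open scoped LSeries.notation

/-! ## §1. Pointwise majorants -/

/-- Divisor-type majorants multiply under Dirichlet convolution (`LSeries.convolution` is the tree's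
`seqConv`): `|u| ≤ C₁τ_{j₁}`, `|v| ≤ C₂τ_{j₂}` ⇒ `|u∗v| ≤ C₁C₂τ_{j₁+j₂}`. [folklore] -/
private theorem norm_convolution_le_tau {u v : ℕ → ℂ} {C₁ C₂ : ℝ} {j₁ j₂ : ℕ} (hC₁ : 0 ≤ C₁)
    (hu : ∀ n, n ≠ 0 → ‖u n‖ ≤ C₁ * tau j₁ n) (hv : ∀ n, n ≠ 0 → ‖v n‖ ≤ C₂ * tau j₂ n) (n : ℕ) :
    ‖(u ⍟ v) n‖ ≤ C₁ * C₂ * tau (j₁ + j₂) n := by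
  have h : (u ⍟ v) n = MeanSquareMajorant.seqConv u v n := by
    simp only [LSeries.convolution_def, MeanSquareMajorant.seqConv]
  rw [h]
  exact MeanSquareMajorant.norm_seqConv_le_tau hC₁ hu hv n

section Pointwise

variable (c' : ℝ) {D : ℕ} (χ : DirichletCharacter ℂ D)

/-- **`|ϱ*_≤(m)| ≤ τ₄(m)`** (`ϱ*_≤ = (ν·[≤D⁴]) ∗ κ̄₂`; `|ν(n)| ≤ τ₂(n)`, `|κ̄₂(n)| = |κ₂^{(b₁)}(n)| ≤ τ₂(n)`).
[cite: Zhang2022LandauSiegel, §17 u017 p.97] -/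
theorem norm_varrhoLe_le_tau (m : ℕ) :
    ‖(trunc (D ^ 4) (nu χ) ⍟ kappa2bar c' D) m‖ ≤ 1 * 1 * tau 4 m := by
  have h1 : ∀ n, n ≠ 0 → ‖trunc (D ^ 4) (nu χ) n‖ ≤ 1 * tau 2 n := by
    intro n _
    rw [one_mul, MeanSquareMajorant.tau_two_apply, trunc]
    split_ifs
    · exact Literature.NumberTheory.LFunctions.norm_divisorSumChar_le χ n
    · rw [norm_zero]; positivity
  have h2 : ∀ n, n ≠ 0 → ‖kappa2bar c' D n‖ ≤ 1 * tau 2 n := by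
    intro n _
    rw [one_mul, MeanSquareMajorant.tau_two_apply, kappa2bar, Complex.norm_conj]
    exact Phi3Eval.norm_kappa₂_le_card_divisors _ n
  exact norm_convolution_le_tau zero_le_one h1 h2 m

/-- **`|((bχ)∗ν₁*)(n)| ≤ (1+|ι₂|)(|ι₃|+|ι₄|)·τ₆(n)`** for `log D ≥ 2`: `|bχ| ≤ Kτ₂` ((15.2),
`norm_bcoef_mul_chi_le`), `|ν₁*| = |υ·[≤D⁴] ∗ nN_{β₂} ∗ nN_{β₃}| ≤ τ₂∗τ₁∗τ₁ = τ₄`.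
[cite: Zhang2022LandauSiegel, §17 (17.8) p.98; (15.2)] -/
theorem norm_bchiConv_le_tau (hD : 2 ≤ Real.log D) (n : ℕ) :
    ‖((fun n => bcoef D n * χ (n : ZMod D)) ⍟ nuOneStar c' χ) n‖ ≤
      (1 + ‖iota2‖) * (‖iota3‖ + ‖iota4‖) * tau 6 n := by
  set K : ℝ := (1 + ‖iota2‖) * (‖iota3‖ + ‖iota4‖) with hK
  have hK0 : 0 ≤ K := by positivity
  have hℓ : 0 < ell D := lt_of_lt_of_le (by norm_num) (show (2 : ℝ) ≤ ell D from hD)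
  have hb : ∀ m, m ≠ 0 → ‖bcoef D m * χ (m : ZMod D)‖ ≤ K * tau 2 m :=
    fun m _ => norm_bcoef_mul_chi_le χ hD m
  have h3 : ∀ m, m ≠ 0 → ‖trunc (D ^ 4) (ups χ) m‖ ≤ 1 * tau 2 m :=
    fun m _ => by rw [one_mul]; exact norm_trunc_ups_le χ m
  have hβ2 : (beta2 c' D).re = 0 := by rw [Typed.Section16A.beta2_eq_b2_mul_I]; simp
  have hβ3 : (beta3 c' D).re = 0 := by rw [Typed.Section16A.beta3_eq_b3_mul_I]; simp
  have h4 : ∀ m, m ≠ 0 → ‖nN D (beta2 c' D) m‖ ≤ 1 * tau 1 m :=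
    fun m hm => by
      rw [MeanSquareMajorant.tau_one_apply hm, mul_one]
      exact Phi3Eval.norm_nN_le_one hℓ hβ2 m
  have h5 : ∀ m, m ≠ 0 → ‖nN D (beta3 c' D) m‖ ≤ 1 * tau 1 m :=
    fun m hm => by
      rw [MeanSquareMajorant.tau_one_apply hm, mul_one]
      exact Phi3Eval.norm_nN_le_one hℓ hβ3 m
  have c1 := fun m (_ : m ≠ 0) => norm_convolution_le_tau zero_le_one h3 h4 m
  have c2 := fun m (_ : m ≠ 0) => norm_convolution_le_tau (by positivity) c1 h5 m
  have c3 := norm_convolution_le_tau hK0 hb c2 n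
  have e : K * (1 * 1 * 1) * tau (2 + (2 + 1 + 1)) n = K * tau 6 n := by norm_num
  rw [nuOneStar]
  rw [e] at c3
  exact c3

end Pointwise

/-! ## §2. Divisor-sum bookkeeping -/

/-- `Σ_{1≤n≤X} τ_j(n)/n ≤ majorantConst(j²,2j)(log X)^{j²} + 1 + log X` for `X ≥ 2`
(`τ ≤ τ² + 1`, the tree's `sum_tau_sq_div_le`, and `Σ_{n≤X} 1/n ≤ 1 + log X`). [folklore] -/
private theorem sum_tau_div_le (j : ℕ) {X : ℕ} (hX : 2 ≤ X) :
    ∑ n ∈ Icc 1 X, tau j n / n ≤ majorantConst (j ^ 2) (2 * j) * Real.log X ^ (j ^ 2) + (1 + Real.log X) := by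
  have h1 := MeanSquareMajorant.sum_tau_sq_div_le j hX
  have h2 : ∑ n ∈ Icc 1 X, (1 : ℝ) / n ≤ 1 + Real.log X := by
    have h := harmonic_le_one_add_log X
    rw [harmonic_eq_sum_Icc] at h
    push_cast at h
    simpa [one_div] using h
  calc ∑ n ∈ Icc 1 X, tau j n / n ≤ ∑ n ∈ Icc 1 X, (tau j n ^ 2 / n + 1 / n) := by
        refine Finset.sum_le_sum fun n hn => ?_
        have hn0 : (0 : ℝ) < n := by exact_mod_cast (Finset.mem_Icc.mp hn).1
        rw [← add_div, div_le_div_iff_of_pos_right hn0]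
        nlinarith [sq_nonneg (tau j n - 1)]
    _ = ∑ n ∈ Icc 1 X, tau j n ^ 2 / n + ∑ n ∈ Icc 1 X, (1 : ℝ) / n := Finset.sum_add_distrib
    _ ≤ _ := add_le_add h1 h2

/-- **The weighted partial sums of a `τ_j`-dominated sequence**: if `|f(n)| ≤ Kτ_j(n)` (`n ≥ 1`),
`e ≥ −1`, `1 ≤ M ≤ X + 1`, `X ≥ 2`, then
`Σ_{1≤n<M} |f(n)|·n^e ≤ K·X^{e+1}·(majorantConst(j²,2j)(log X)^{j²} + 1 + log X)`
(`n^e = n^{e+1}/n ≤ X^{e+1}/n`). [cite: Zhang2022LandauSiegel, §17 (17.8) p.98] -/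
theorem sum_norm_mul_rpow_le_of_tau {f : ℕ → ℂ} {K : ℝ} {j : ℕ} (hK : 0 ≤ K)
    (hf : ∀ n, n ≠ 0 → ‖f n‖ ≤ K * tau j n) {e : ℝ} (he : -1 ≤ e) {M X : ℕ} (hMX : M ≤ X + 1)
    (hX : 2 ≤ X) :
    ∑ n ∈ Ico 1 M, ‖f n‖ * (n : ℝ) ^ e ≤
      K * (X : ℝ) ^ (e + 1) * (majorantConst (j ^ 2) (2 * j) * Real.log X ^ (j ^ 2) + (1 + Real.log X)) := by
  have hX0 : (0 : ℝ) < X := by exact_mod_cast (show 0 < X by omega)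
  have hsub : Ico 1 M ⊆ Icc 1 X := fun n hn => by
    rw [Finset.mem_Ico] at hn; rw [Finset.mem_Icc]; omega
  have hterm : ∀ n ∈ Icc 1 X, ‖f n‖ * (n : ℝ) ^ e ≤ K * (X : ℝ) ^ (e + 1) * (tau j n / n) := by
    intro n hn
    have hn1 : 1 ≤ n := (Finset.mem_Icc.mp hn).1
    have hnX : (n : ℝ) ≤ X := by exact_mod_cast (Finset.mem_Icc.mp hn).2
    have hn0 : (0 : ℝ) < n := by exact_mod_cast hn1
    have hne : (n : ℝ) ^ e = (n : ℝ) ^ (e + 1) / n := by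
      rw [Real.rpow_add hn0, Real.rpow_one, mul_div_assoc, div_self hn0.ne', mul_one]
    have hpow : (n : ℝ) ^ (e + 1) ≤ (X : ℝ) ^ (e + 1) :=
      Real.rpow_le_rpow hn0.le hnX (by linarith)
    rw [hne]
    calc ‖f n‖ * ((n : ℝ) ^ (e + 1) / n) ≤ (K * tau j n) * ((X : ℝ) ^ (e + 1) / n) :=
          mul_le_mul (hf n (by omega)) (div_le_div_of_nonneg_right hpow hn0.le) (by positivity)
            (mul_nonneg hK (MeanSquareMajorant.tau_nonneg j n))
      _ = K * (X : ℝ) ^ (e + 1) * (tau j n / n) := by ring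
  calc ∑ n ∈ Ico 1 M, ‖f n‖ * (n : ℝ) ^ e ≤ ∑ n ∈ Icc 1 X, ‖f n‖ * (n : ℝ) ^ e :=
        Finset.sum_le_sum_of_subset_of_nonneg hsub fun n _ _ => by positivity
    _ ≤ ∑ n ∈ Icc 1 X, K * (X : ℝ) ^ (e + 1) * (tau j n / n) := Finset.sum_le_sum hterm
    _ = K * (X : ℝ) ^ (e + 1) * ∑ n ∈ Icc 1 X, tau j n / n := by rw [Finset.mul_sum]
    _ ≤ _ := by
        have h0 : 0 ≤ K * (X : ℝ) ^ (e + 1) := by positivity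
        exact mul_le_mul_of_nonneg_left (sum_tau_div_le j hX) h0

/-- The same over `Finset.range M` (the near sum of `norm_offDiagonal_near_far_le`; the term `n = 0`
vanishes). [cite: Zhang2022LandauSiegel, §17 (17.8) p.98] -/
theorem sum_range_norm_mul_rpow_le_of_tau {f : ℕ → ℂ} (hf0 : f 0 = 0) {K : ℝ} {j : ℕ} (hK : 0 ≤ K)
    (hf : ∀ n, n ≠ 0 → ‖f n‖ ≤ K * tau j n) {e : ℝ} (he : -1 ≤ e) {M X : ℕ} (hMX : M ≤ X + 1)
    (hX : 2 ≤ X) :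
    ∑ n ∈ Finset.range M, ‖f n‖ * (n : ℝ) ^ e ≤
      K * (X : ℝ) ^ (e + 1) * (majorantConst (j ^ 2) (2 * j) * Real.log X ^ (j ^ 2) + (1 + Real.log X)) := by
  have hsplit : ∑ n ∈ Finset.range M, ‖f n‖ * (n : ℝ) ^ e = ∑ n ∈ Ico 1 M, ‖f n‖ * (n : ℝ) ^ e := by
    rcases Nat.eq_zero_or_pos M with rfl | hM
    · simp
    · rw [Finset.range_eq_Ico, ← Finset.sum_Ico_consecutive _ (Nat.zero_le 1) hM]
      simp [hf0]
  rw [hsplit]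
  exact sum_norm_mul_rpow_le_of_tau hK hf he hMX hX

/-- **Products of two `τ`-dominated sequences, summed with `1/n`**: `|f| ≤ K₁τ_i`, `|g| ≤ K₂τ_j` ⇒
`Σ_{1≤n<M}|f(n)||g(n)|/n ≤ K₁K₂·(majorantConst(i²,2i)(log X)^{i²} + majorantConst(j²,2j)(log X)^{j²})`
(`τ_iτ_j ≤ (τ_i² + τ_j²)/2 ≤ τ_i² + τ_j²`). [cite: Zhang2022LandauSiegel, §17 (17.8) p.98] -/
theorem sum_norm_mul_norm_div_le_of_tau {f g : ℕ → ℂ} {K₁ K₂ : ℝ} {i j : ℕ} (hK₁ : 0 ≤ K₁)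
    (hK₂ : 0 ≤ K₂) (hf : ∀ n, n ≠ 0 → ‖f n‖ ≤ K₁ * tau i n) (hg : ∀ n, n ≠ 0 → ‖g n‖ ≤ K₂ * tau j n)
    {M X : ℕ} (hMX : M ≤ X + 1) (hX : 2 ≤ X) :
    ∑ n ∈ Ico 1 M, ‖f n‖ * ‖g n‖ / n ≤
      K₁ * K₂ * (majorantConst (i ^ 2) (2 * i) * Real.log X ^ (i ^ 2) +
        majorantConst (j ^ 2) (2 * j) * Real.log X ^ (j ^ 2)) := by
  have hsub : Ico 1 M ⊆ Icc 1 X := fun n hn => by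
    rw [Finset.mem_Ico] at hn; rw [Finset.mem_Icc]; omega
  have hi := MeanSquareMajorant.sum_tau_sq_div_le i hX
  have hj := MeanSquareMajorant.sum_tau_sq_div_le j hX
  have hterm : ∀ n ∈ Icc 1 X, ‖f n‖ * ‖g n‖ / n ≤ K₁ * K₂ * (tau i n ^ 2 / n + tau j n ^ 2 / n) := by
    intro n hn
    have hn1 : 1 ≤ n := (Finset.mem_Icc.mp hn).1
    have hn0 : (0 : ℝ) < n := by exact_mod_cast hn1
    have h1 := hf n (by omega)
    have h2 := hg n (by omega)
    rw [← add_div, div_le_iff₀ hn0]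
    have hprod : ‖f n‖ * ‖g n‖ ≤ (K₁ * tau i n) * (K₂ * tau j n) :=
      mul_le_mul h1 h2 (norm_nonneg _) (mul_nonneg hK₁ (MeanSquareMajorant.tau_nonneg i n))
    have hamgm : tau i n * tau j n ≤ tau i n ^ 2 + tau j n ^ 2 := by
      nlinarith [sq_nonneg (tau i n - tau j n), MeanSquareMajorant.tau_nonneg i n,
        MeanSquareMajorant.tau_nonneg j n]
    have e : K₁ * K₂ * ((tau i n ^ 2 + tau j n ^ 2) / n) * n = K₁ * K₂ * (tau i n ^ 2 + tau j n ^ 2) := by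
      field_simp
    rw [e]
    calc ‖f n‖ * ‖g n‖ ≤ (K₁ * tau i n) * (K₂ * tau j n) := hprod
      _ = K₁ * K₂ * (tau i n * tau j n) := by ring
      _ ≤ K₁ * K₂ * (tau i n ^ 2 + tau j n ^ 2) := by gcongr
  calc ∑ n ∈ Ico 1 M, ‖f n‖ * ‖g n‖ / n ≤ ∑ n ∈ Icc 1 X, ‖f n‖ * ‖g n‖ / n :=
        Finset.sum_le_sum_of_subset_of_nonneg hsub fun n _ _ => by positivity
    _ ≤ ∑ n ∈ Icc 1 X, K₁ * K₂ * (tau i n ^ 2 / n + tau j n ^ 2 / n) := Finset.sum_le_sum hterm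
    _ = K₁ * K₂ * (∑ n ∈ Icc 1 X, tau i n ^ 2 / n + ∑ n ∈ Icc 1 X, tau j n ^ 2 / n) := by
        rw [← Finset.sum_add_distrib, Finset.mul_sum]
    _ ≤ _ := by gcongr

/-- **`Σ_m |a(m)|m^{−3/2} ≤ C·Σ_m m^{−5/4}`** whenever `|a(m)| ≤ Cm^{1/4}` — the absolute constant
bounding the infinite side of the double sum (generic form of `Section17Eq173Sizes.tsum_norm_term_nuStar_le`),
together with the summability of `a` at `σ = 3/2`. [cite: Zhang2022LandauSiegel, §17 (17.3), (17.8)] -/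
theorem tsum_norm_term_le_of_rpow {a : ℕ → ℂ} {C : ℝ} (hC : ∀ n : ℕ, ‖a n‖ ≤ C * (n : ℝ) ^ (1 / 4 : ℝ)) :
    LSeriesSummable a (3 / 2 : ℂ) ∧
      ∑' m : ℕ, ‖LSeries.term a (3 / 2 : ℂ) m‖ ≤ C * ∑' m : ℕ, (m : ℝ) ^ (-(5 / 4 : ℝ)) := by
  have hsumA : LSeriesSummable a (3 / 2 : ℂ) := by
    refine LSeriesSummable_of_le_const_mul_rpow (x := 5 / 4) (by norm_num) ⟨C, fun n _ => ?_⟩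
    have := hC n
    norm_num at this ⊢
    exact this
  refine ⟨hsumA, ?_⟩
  have hC0 : 0 ≤ C := by
    have := hC 1; simp at this; exact (norm_nonneg _).trans this
  have hsum : Summable fun m : ℕ => (m : ℝ) ^ (-(5 / 4 : ℝ)) :=
    Real.summable_nat_rpow.mpr (by norm_num)
  rw [← tsum_mul_left]
  refine Summable.tsum_le_tsum (fun m => ?_) (summable_norm_iff.mpr hsumA) (hsum.mul_left C)
  rcases Nat.eq_zero_or_pos m with rfl | hm
  · simp
  · rw [LSeries.norm_term_eq, if_neg hm.ne']
    have hm' : (0 : ℝ) < m := Nat.cast_pos.mpr hm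
    rw [div_le_iff₀ (Real.rpow_pos_of_pos hm' _)]
    calc ‖a m‖ ≤ C * (m : ℝ) ^ (1 / 4 : ℝ) := hC m
      _ = C * (m : ℝ) ^ (-(5 / 4 : ℝ)) * (m : ℝ) ^ ((3 / 2 : ℂ).re) := by
          rw [mul_assoc, ← Real.rpow_add hm']; norm_num

/-- **`|ϱ*_≤(m)| ≤ C·m^{1/4}` with an ABSOLUTE `C`** (every `D`, `χ`, `c′`): `τ₄(m) ≤ Cm^{1/4}` by the
divisor bound (`exists_tau_succ_le_mul_rpow`). [cite: Zhang2022LandauSiegel, §17 u017 p.97] -/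
theorem exists_norm_varrhoLe_le_rpow : ∃ C : ℝ, 0 ≤ C ∧ ∀ (c' : ℝ) (D : ℕ) (χ : DirichletCharacter ℂ D)
    (m : ℕ), ‖(trunc (D ^ 4) (nu χ) ⍟ kappa2bar c' D) m‖ ≤ C * (m : ℝ) ^ (1 / 4 : ℝ) := by
  obtain ⟨C, hC0, hC⟩ := exists_tau_succ_le_mul_rpow 3 (show (0 : ℝ) < 1 / 4 by norm_num)
  refine ⟨C, hC0, fun c' D χ m => ?_⟩
  rcases eq_or_ne m 0 with rfl | hm
  · simp
  · calc ‖(trunc (D ^ 4) (nu χ) ⍟ kappa2bar c' D) m‖ ≤ 1 * 1 * tau 4 m := norm_varrhoLe_le_tau c' χ m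
      _ = tau (3 + 1) m := by norm_num
      _ ≤ C * (m : ℝ) ^ (1 / 4 : ℝ) := hC m hm

end Literature.NumberTheory.LFunctions.Zhang2022.Phi3Minus
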